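import Summits.Ventures.Crystal3D.Theorems.StickyWulffConstantTextureBuildCellsLabels
import HarnessLib

/-!
# TB-energy blueprint, the EXPOSED/CONTACT engine, part 1: anatomy of UNLABELLED cells and the solid-void contradiction
# (lane T, crux `TextureLiminfV5`, stmt-Ventures-23912; TB-D-3-g20 §engine (V10, SV); serves stub_LP1 / stub_LP2)

HONEST FRAMING. Venture `Summits/Ventures/Crystal3D` (cell `crystal3d-full`), route `route-Ventures-StickyWulffConstant`, helper `--supports` the
law-v5 crux `TextureLiminfV5` (stmt-Ventures-23912).  Bookkeeping over the labelled cells of a texture input (standard axioms; no mesh constructed; F-C1 not moved).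

WHAT (TB-D-3 V10 + SV).  In the cell architecture the flip cell across an exposed facet is UNLABELLED; this file says what an unlabelled cell is:
* `disjoint_of_lab_none` — it is disjoint from every core / prism / gap-piece / riser-box polytope (hence from their closures, `disjoint_closure_of_lab_none`);
* `disjoint_certH_of_lab_none`, `disjoint_G_of_lab_none`, `subset_U_of_lab_none` — inside a territory `D_f` it misses the tent solid `G_f` and lies in the free
  zone `U_f` (it is TENT-VOID);
* `false_of_void_solidAt` — (SV) a tent-void cell cannot meet an open set on whose `U_f`-points `f` is solid (solid points are a.e. in `G_f`).
-/

noncomputable section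

open scoped BigOperators InnerProductSpace ENNReal
open MeasureTheory Set

namespace Summit.Ventures.Crystal3D.Cruxes.TextureLiminf.TexShadow

open Summit.Ventures.Crystal3D Summit.Ventures.Crystal3D.Theorems

namespace TexInput

variable {C R₀ : ℝ} {N : ℕ} {x : Fin N → E3} {rc : RiseredCover C R₀ N x} {δ : ℝ} {μ : Mesh₅ rc δ} (I : TexInput rc μ)

/-- Cells are open. -/
theorem isOpen_cell (j : Fin I.cells.k) : IsOpen (I.cells.cell j) := by
  unfold LabelledCells.cell polytope
  exact isOpen_biInter_finset fun q _ => isOpen_lt (continuous_const.inner continuous_id) continuous_const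

/-- **(V10a) An unlabelled cell is disjoint from every core, prism, gap piece and riser box.** -/
theorem disjoint_of_lab_none {j : Fin I.cells.k} (hlab : I.cells.lab j = none) {G : Finset (E3 × ℝ)} (hG𝓗 : G ⊆ I.𝓗)
    (hG : (∃ f j', G = μ.HC f j') ∨ (∃ k, G = μ.HP k) ∨ (∃ l, G = μ.HQ l) ∨ (∃ r, G = μ.HB r)) :
    Disjoint (I.cells.cell j) (polytope G) := by
  rw [Set.disjoint_left]
  intro z hz hzG
  have h := I.isSome_lab_of_subset j hG𝓗 hG (refineCells_subset_of_mem _ _ _ _ _ _ _ j hG𝓗 hz hzG)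
  rw [hlab] at h
  exact Bool.false_ne_true h

/-- The same for the closures (cells are open). -/
theorem disjoint_closure_of_lab_none {j : Fin I.cells.k} (hlab : I.cells.lab j = none) {G : Finset (E3 × ℝ)} (hG𝓗 : G ⊆ I.𝓗)
    (hG : (∃ f j', G = μ.HC f j') ∨ (∃ k, G = μ.HP k) ∨ (∃ l, G = μ.HQ l) ∨ (∃ r, G = μ.HB r)) :
    Disjoint (I.cells.cell j) (closure (polytope G)) :=
  ((I.disjoint_of_lab_none hlab hG𝓗 hG).symm.closure_left (I.isOpen_cell j)).symm

/-- **(V10b) An unlabelled cell inside a territory misses every certificate piece of that grain.** -/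
theorem disjoint_certH_of_lab_none {j : Fin I.cells.k} (hlab : I.cells.lab j = none) {f : Fin rc.ng} {jd : Fin (μ.nD f)}
    (hD : I.cells.cell j ⊆ polytope (μ.HD f jd)) (jc : Fin (I.ct f).J) : Disjoint (I.cells.cell j) (polytope ((I.ct f).H jc)) := by
  rw [Set.disjoint_left]
  intro z hz hzH
  have hne : (polytope (signedH I.𝓗 (I.cells.T j))).Nonempty := ⟨z, hz⟩
  have hH : (I.ct f).H jc ⊆ I.cells.T j :=
    subset_T_of_cell_subset (I.certH_subset_𝓗 f jc) hne (refineCells_subset_of_mem _ _ _ _ _ _ _ j (I.certH_subset_𝓗 f jc) hz hzH)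
  have hHD : μ.HD f jd ⊆ I.cells.T j := subset_T_of_cell_subset (I.HD_subset_𝓗 f jd) hne hD
  have hgr := I.isSome_grainOf (T := I.cells.T j) (Or.inr (Or.inl ⟨f, ⟨jc, hH⟩, ⟨jd, hHD⟩⟩))
  obtain ⟨g, hg⟩ := Option.isSome_iff_exists.1 hgr
  have h := I.isSome_lab_of_grainOf j hg
  rw [hlab] at h
  exact Bool.false_ne_true h

/-- **(V10c) An unlabelled cell inside a territory misses the tent solid.** -/
theorem disjoint_G_of_lab_none {j : Fin I.cells.k} (hlab : I.cells.lab j = none) {f : Fin rc.ng} {jd : Fin (μ.nD f)}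
    (hD : I.cells.cell j ⊆ polytope (μ.HD f jd)) : Disjoint (I.cells.cell j) (I.ct f).G := by
  rw [(I.ct f).hG, Set.disjoint_iUnion_right]
  exact fun jc => I.disjoint_certH_of_lab_none hlab hD jc

/-- **(V10d) An unlabelled cell inside a territory lies in the free zone.** -/
theorem subset_U_of_lab_none {j : Fin I.cells.k} (hlab : I.cells.lab j = none) {f : Fin rc.ng} {jd : Fin (μ.nD f)}
    (hD : I.cells.cell j ⊆ polytope (μ.HD f jd)) : I.cells.cell j ⊆ (rc.tent f).U := by
  rw [μ.hU f]
  intro z hz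
  refine ⟨mem_iUnion.2 ⟨jd, hD hz⟩, fun hzc => ?_⟩
  -- the cell misses the closure of the core: it is open and misses every core polytope
  have hdisj : Disjoint (I.cells.cell j) (⋃ jc, polytope (μ.HC f jc)) :=
    Set.disjoint_iUnion_right.2 fun jc => I.disjoint_of_lab_none hlab (I.HC_subset_𝓗 f jc) (Or.inl ⟨f, jc, rfl⟩)
  exact Set.disjoint_left.1 ((hdisj.symm.closure_left (I.isOpen_cell j)).symm) hz hzc

/-- **(SV) THE SOLID-VOID CONTRADICTION**: an unlabelled cell inside `D_f` cannot meet an open set on whose free-zone points `f` is solid. -/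
theorem false_of_void_solidAt {j : Fin I.cells.k} (hlab : I.cells.lab j = none) {f : Fin rc.ng} {jd : Fin (μ.nD f)}
    (hD : I.cells.cell j ⊆ polytope (μ.HD f jd)) {B : Set E3} (hB : IsOpen B) (hsol : ∀ z ∈ B, z ∈ (rc.tent f).U → rc.SolidAt f z)
    (hne : (I.cells.cell j ∩ B).Nonempty) : False := by
  have hpos : 0 < volume (I.cells.cell j ∩ B) := ((I.isOpen_cell j).inter hB).measure_pos volume hne
  have hsub : I.cells.cell j ∩ B ⊆
      {y : E3 | ∀ b ∈ stacking (rc.tent f).L (rc.tent f).s (rc.tent f).σ, dist y b ≤ Real.sqrt 2 → b ∈ (rc.tent f).Xh} \ (I.ct f).G := by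
    rintro z ⟨hzj, hzB⟩
    exact ⟨hsol z hzB (I.subset_U_of_lab_none hlab hD hzj), fun hzG => Set.disjoint_left.1 (I.disjoint_G_of_lab_none hlab hD) hzj hzG⟩
  have h0 : volume (I.cells.cell j ∩ B) = 0 := measure_mono_null hsub (I.ct f).hmass
  rw [h0] at hpos
  exact lt_irrefl _ hpos

/-- A cell meeting a territory polytope lies inside it (dichotomy), packaged. -/
theorem cell_subset_HD_of_mem {j : Fin I.cells.k} {f : Fin rc.ng} {jd : Fin (μ.nD f)} {z : E3} (hz : z ∈ I.cells.cell j)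
    (hzD : z ∈ polytope (μ.HD f jd)) : I.cells.cell j ⊆ polytope (μ.HD f jd) :=
  refineCells_subset_of_mem _ _ _ _ _ _ _ j (I.HD_subset_𝓗 f jd) hz hzD

/-- **An unlabelled cell meeting a territory is tent-void there**: it lies in `U_f` and misses `G_f`. -/
theorem void_of_lab_none_of_mem {j : Fin I.cells.k} (hlab : I.cells.lab j = none) {f : Fin rc.ng} {z : E3} (hz : z ∈ I.cells.cell j)
    (hzD : z ∈ ⋃ jd, polytope (μ.HD f jd)) : I.cells.cell j ⊆ (rc.tent f).U ∧ Disjoint (I.cells.cell j) (I.ct f).G := by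
  obtain ⟨jd, hjd⟩ := mem_iUnion.1 hzD
  have hD := I.cell_subset_HD_of_mem hz hjd
  exact ⟨I.subset_U_of_lab_none hlab hD, I.disjoint_G_of_lab_none hlab hD⟩

end TexInput

end Summit.Ventures.Crystal3D.Cruxes.TextureLiminf.TexShadow

end
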